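import Summits.CriticalPhenomena.CardyFormulaZ2.Theses.CardyCornerFugacity

/-!
# Birth skeleton `birth` for crux `SeqConfTransport` (stmt-CriticalPhenomena-7313)

Route `CardyCornerFugacity`, sub-problem `CardyFormulaZ2` (skeleton registrar
`planner-skel-stmt-CriticalPhenomena-7313-0`, 2026-08-17). THREE registered stubs
`stub_meshLoopContinuity`, `stub_rectilinearSeqTransport`, `stub_isomodularRectilinearApprox`
(sorried) and the sorry-free composition `SeqConfTransport_of`, whose conclusion is literally the
route decl `Summit.CriticalPhenomena.CardyFormulaZ2.Theses.CardyCornerFugacity.SeqConfTransport`.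

## The crux

`SeqConfTransport` (conformal transport of SUBSEQUENTIAL crossing limits of bond-`ℤ²` percolation at
`p = 1/2`): if two conformal rectangles `R`, `R'` have uniformizing data of equal Cardy cross-ratio,
`s k → 0⁺` is any mesh sequence and `bondDomainCrossingProb R (s k) → L`, then
`bondDomainCrossingProb R' (s k) → L`. No existence of limits is asserted (strictly weaker than
`X_U` = stmt-0745 and than `LimitExists ∧ ConfInvTransport` = stmt-0747 ∧ stmt-0794).

## The line in one paragraph (dense class + sequential closure)

Write `P(R, δ) = bondDomainCrossingProb R δ` and call a conformal rectangle RECTILINEAR when its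
Jordan boundary lies in finitely many axis-parallel segments (the predicate of the sibling items
`CardyBoundaryCoulombGas.RectilinearCardy / RectilinearSuffices`, dense in the marked-loop topology
by the tree theorem `Theorems.exists_rectilinear_close`). The crux is cut into

* **S1 `stub_meshLoopContinuity` (a-priori estimate, percolation; size M–L).** Mesh-uniform
  continuity of `P(·, δ)` in the marked-loop topology: for every `R` and `τ > 0` there is `ε₀ > 0`
  such that every conformal rectangle `Q` whose boundary loop is pointwise `ε₀`-close to that of
  `R` and whose mark parameters are `ε₀`-close has `|P(Q, δ) - P(R, δ)| ≤ τ` for all small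
  meshes `δ` (eventually along `𝓝[>] 0`). It asserts no limit and no conformal invariance; it is
  the SEQUENTIAL twin of the loop continuity of full limits (`SimilarityUpgrade.stub_loopContinuity`)
  and of the sandwich built for `RectilinearSuffices`; it is implied by the conjunct (Cardy values
  + Radó continuity of the modulus + continuity of `F`).
* **S2 `stub_rectilinearSeqTransport` (the HEART; open-problem class).** The crux verbatim for
  RECTILINEAR `R`, `R'`: conformal transport of subsequential crossing limits between lattice-type
  polygons of equal modulus (an L-shape and a rectangle, two rectangles differing by a non-lattice
  rotation, …). All the open content (dilation / Möbius covariance of `ℤ²` subsequential limits)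
  is kept, but on domains with flat sides, Schwarz–Christoffel structure and the exact quarter-turn
  and reflection symmetries of `ℤ²`, where half-plane arm estimates, DKKMO rotation invariance and
  the boundary transfer-matrix tools of `CardyBoundaryCoulombGas` live.
* **S3 `stub_isomodularRectilinearApprox` (complex analysis, model-free, provable now; size M).**
  Every conformal rectangle `R` with uniformizing datum `(φ, x)` has, for every `ε₀ > 0`, a
  RECTILINEAR conformal rectangle `Q`, `ε₀`-close in the marked-loop topology, with a uniformizing
  datum of EXACTLY the same cross-ratio. (Rectilinear approximant with the same marks —
  `exists_rectilinear_close` — then slide the parameter of mark 1 by at most `ε₀`: the cross-ratio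
  is continuous (Radó, `ConformalRectangle.tendsto_crossRatio_of_tendsto_mark`) and strictly
  monotone in that mark, so the intermediate value theorem hits `crossRatio x`.)

Composition (`SeqConfTransport_of`, proved here, ~40 lines of real analysis): given `R, R'` of
equal modulus, `s → 0⁺` and `P(R, s k) → L`, suppose `P(R', s k)` stays `ε`-far from `L` along a
subsequence `ns` (`Filter.exists_seq_forall_of_frequently`). Take iso-modular rectilinear
approximants `Q` of `R` and `Q'` of `R'` inside the `ε/4`-continuity radii of S1 (S3), a further
subsequence `θ` with `P(Q, s (ns (θ k))) → L_Q` (Bolzano–Weierstrass in `[0,1]`); then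
`|L_Q - L| ≤ ε/4` (S1 at `R`), `P(Q', s (ns (θ k))) → L_Q` (S2: `η(Q) = η(R) = η(R') = η(Q')`),
and S1 at `R'` gives `|P(R', ·) - L| < 3ε/4` far out along `ns ∘ θ` — contradiction.

## Disproof used

None on file: `ledger crux ls stmt-CriticalPhenomena-7313` showed no workfiles (no `Disproof.lean`,
no `Lines/*`, no landed `Theorems/SeqConfTransport/Negative/*`) at registration, 2026-08-17.
Negatives index (`ledger negatives --problem CriticalPhenomena`, 11 entries) checked: the only
crossing-probability negative, stmt-0748 (no conformal rectangle has frequently degenerate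
crossing probabilities), is consistent with S1–S3; stmt-0698 (`SymmetryUpgrade` over abstract
chordal families) is avoided because every stub speaks of the honest bond-`ℤ²` probabilities
`bondDomainCrossingProb`, never of an axiomatised family.
-/

noncomputable section

namespace Summit.CriticalPhenomena.CardyFormulaZ2.Cruxes.SeqConfTransport.Birth

open Filter Topology Set
open Literature.Probability.RandomPlanarGeometry
open Literature.Probability.Percolation (bondDomainCrossingProb bondDomainCrossingProb_mem_Icc)

/-! ### Vocabulary of the line (named statements; the stubs below restate them verbatim) -/

/-- Rectilinear conformal rectangles: the Jordan boundary lies in finitely many axis-parallel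
segments (the predicate of `CardyBoundaryCoulombGas.RectilinearCardy`, verbatim). [folklore] -/
def IsRectilinear (R : ConformalRectangle) : Prop :=
  ∃ S : Finset (ℂ × ℂ), (∀ p ∈ S, p.1.re = p.2.re ∨ p.1.im = p.2.im) ∧
    frontier R.carrier ⊆ ⋃ p ∈ S, segment ℝ p.1 p.2

/-- **S1** — mesh-uniform continuity of the bond-`ℤ²` crossing probabilities in the marked-loop
topology (pointwise closeness of the boundary loops + closeness of the mark parameters). [folklore] -/
def MeshLoopContinuity : Prop :=
  ∀ R : ConformalRectangle, ∀ τ : ℝ, 0 < τ → ∃ ε₀ : ℝ, 0 < ε₀ ∧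
    ∀ Q : ConformalRectangle, (∀ u : ℝ, dist (Q.boundary u) (R.boundary u) ≤ ε₀) →
      (∀ i : Fin 4, |Q.mark i - R.mark i| ≤ ε₀) →
      ∀ᶠ δ in 𝓝[>] (0 : ℝ), |bondDomainCrossingProb Q δ - bondDomainCrossingProb R δ| ≤ τ

/-- **S2** — the crux on the rectilinear class: conformal transport of subsequential crossing
limits between rectilinear conformal rectangles of equal modulus. [folklore] -/
def RectilinearSeqTransport : Prop :=
  ∀ (R R' : ConformalRectangle), IsRectilinear R → IsRectilinear R' →
    ∀ (φ : ConformalEquiv UpperHalfPlane.upperHalfPlaneSet R.carrier) (x : Fin 4 → ℝ)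
      (φ' : ConformalEquiv UpperHalfPlane.upperHalfPlaneSet R'.carrier) (x' : Fin 4 → ℝ),
      R.IsUniformizing φ x → R'.IsUniformizing φ' x' → crossRatio x = crossRatio x' →
      ∀ s : ℕ → ℝ, Tendsto s atTop (𝓝[>] (0 : ℝ)) → ∀ L : ℝ,
        Tendsto (fun k ↦ bondDomainCrossingProb R (s k)) atTop (𝓝 L) →
        Tendsto (fun k ↦ bondDomainCrossingProb R' (s k)) atTop (𝓝 L)

/-- **S3** — iso-modular rectilinear approximation in the marked-loop topology. [folklore] -/
def IsomodularRectilinearApprox : Prop :=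
  ∀ (R : ConformalRectangle) (φ : ConformalEquiv UpperHalfPlane.upperHalfPlaneSet R.carrier)
    (x : Fin 4 → ℝ), R.IsUniformizing φ x → ∀ ε₀ : ℝ, 0 < ε₀ →
    ∃ (Q : ConformalRectangle) (ψ : ConformalEquiv UpperHalfPlane.upperHalfPlaneSet Q.carrier)
      (y : Fin 4 → ℝ), IsRectilinear Q ∧ Q.IsUniformizing ψ y ∧ crossRatio y = crossRatio x ∧
      (∀ u : ℝ, dist (Q.boundary u) (R.boundary u) ≤ ε₀) ∧
      (∀ i : Fin 4, |Q.mark i - R.mark i| ≤ ε₀)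

/-! ### Registered stubs (signatures spelled out over tree declarations) -/

/-- **stub_meshLoopContinuity (S1, size M–L; a-priori estimate, no limit, no conformal
invariance).** For every conformal rectangle `R` and `τ > 0` there is `ε₀ > 0` such that every
conformal rectangle `Q` with boundary loop pointwise `ε₀`-close to `R.boundary` and mark parameters
`ε₀`-close to `R.mark` satisfies `|P(Q, δ) - P(R, δ)| ≤ τ` eventually as `δ → 0⁺`
(`P = bondDomainCrossingProb`). Why plausibly true: it follows from the conjunct (both families
tend to `F (η Q)`, `F (η R)`, and `F ∘ η` is continuous in the marked-loop topology by Radó,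
`ConformalRectangle.tendsto_crossRatio_of_tendsto_mark` + `continuousOn_cardyFunction_Ioo`);
unconditionally it is RSW + half-plane three-arm "no jump" at the marks and along close boundary
pieces, the sequential twin of the sandwich machinery of `RectilinearSuffices` (stmt-5663).
Why it might fail: only through wild Jordan boundaries at the marks (fjords at lattice scales),
where the δ-uniformity is unwritten. [cite: CamiaNewman2007, Thm 3 and §6]
[cite: BollobasRiordan2006, Ch. 7 remark p. 195] -/
theorem stub_meshLoopContinuity :
    ∀ R : ConformalRectangle, ∀ τ : ℝ, 0 < τ → ∃ ε₀ : ℝ, 0 < ε₀ ∧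
      ∀ Q : ConformalRectangle, (∀ u : ℝ, dist (Q.boundary u) (R.boundary u) ≤ ε₀) →
        (∀ i : Fin 4, |Q.mark i - R.mark i| ≤ ε₀) →
        ∀ᶠ δ in 𝓝[>] (0 : ℝ), |bondDomainCrossingProb Q δ - bondDomainCrossingProb R δ| ≤ τ := by
  sorry

/-- **stub_rectilinearSeqTransport (S2, the HEART; open-problem class).** Conformal transport of
subsequential bond-`ℤ²` crossing limits between RECTILINEAR conformal rectangles: if `R`, `R'` are
rectilinear with uniformizing data of equal cross-ratio, `s k → 0⁺` and `P(R, s k) → L`, then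
`P(R', s k) → L`. It is the crux verbatim on the dense rectilinear class (flat sides, lattice
symmetries, Schwarz–Christoffel uniformisation). Why it might fail / why open: it still contains
dilation and Möbius covariance of `ℤ²` subsequential limits (only rotations are known, DKKMO
Thm 1.2); a log-periodic, rotation- but not dilation-covariant subsequential limit would kill it
(and the conjunct with it). [cite: DKKMO2020Rotational, Thm 1.2] [cite: Schramm2007ICM, Problem 2.11]
[cite: Smirnov2001, Thm 1 and closing remark] -/
theorem stub_rectilinearSeqTransport :
    ∀ (R R' : ConformalRectangle),
      (∃ S : Finset (ℂ × ℂ), (∀ p ∈ S, p.1.re = p.2.re ∨ p.1.im = p.2.im) ∧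
        frontier R.carrier ⊆ ⋃ p ∈ S, segment ℝ p.1 p.2) →
      (∃ S : Finset (ℂ × ℂ), (∀ p ∈ S, p.1.re = p.2.re ∨ p.1.im = p.2.im) ∧
        frontier R'.carrier ⊆ ⋃ p ∈ S, segment ℝ p.1 p.2) →
      ∀ (φ : ConformalEquiv UpperHalfPlane.upperHalfPlaneSet R.carrier) (x : Fin 4 → ℝ)
        (φ' : ConformalEquiv UpperHalfPlane.upperHalfPlaneSet R'.carrier) (x' : Fin 4 → ℝ),
        R.IsUniformizing φ x → R'.IsUniformizing φ' x' → crossRatio x = crossRatio x' →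
        ∀ s : ℕ → ℝ, Tendsto s atTop (𝓝[>] (0 : ℝ)) → ∀ L : ℝ,
          Tendsto (fun k ↦ bondDomainCrossingProb R (s k)) atTop (𝓝 L) →
          Tendsto (fun k ↦ bondDomainCrossingProb R' (s k)) atTop (𝓝 L) := by
  sorry

/-- **stub_isomodularRectilinearApprox (S3, size M; complex analysis, model-free, provable now
from tree theorems).** For every conformal rectangle `R` with uniformizing datum `(φ, x)` and every
`ε₀ > 0` there is a RECTILINEAR conformal rectangle `Q` with boundary loop pointwise `ε₀`-close to
`R.boundary`, mark parameters `ε₀`-close to `R.mark`, and a uniformizing datum `(ψ, y)` with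
`crossRatio y = crossRatio x` exactly. Plan: rectilinear approximant with the SAME marks and
`ε₀`-close loop (`Theorems.exists_rectilinear_close`); its modulus is close to, not equal to,
`crossRatio x`; slide the parameter of mark 1 inside `[R.mark 1 - ε₀, R.mark 1 + ε₀]`: the modulus
is continuous in the mark (Radó, `ConformalRectangle.tendsto_crossRatio_of_tendsto_mark` with a
constant loop) and strictly increasing in the boundary preimage `x₁ ∈ (x₀, x₂)`
(`∂η/∂x₁ ∝ (x₃ - x₀)/(x₁ - x₃)² > 0`), and for fine approximants the slid moduli at the two window
ends straddle `crossRatio x` (joint Radó continuity at `R`), so the intermediate value theorem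
applies; data by `MarkedDomain.exists_isUniformizing_holds`, well-definedness by
`ConformalRectangle.crossRatio_eq_of_isUniformizing_holds`. Why it might fail: formalisation only
(re-marking a `MarkedDomain` keeps `StrictMono mark` and `mark ∈ Ico 0 1` for small slides).
[cite: PommerenkeBBCM1992, Thm. 2.11 and Cor. 2.4] [cite: Ahlfors1979, Ch. 3 §3.1] -/
theorem stub_isomodularRectilinearApprox :
    ∀ (R : ConformalRectangle) (φ : ConformalEquiv UpperHalfPlane.upperHalfPlaneSet R.carrier)
      (x : Fin 4 → ℝ), R.IsUniformizing φ x → ∀ ε₀ : ℝ, 0 < ε₀ →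
      ∃ (Q : ConformalRectangle) (ψ : ConformalEquiv UpperHalfPlane.upperHalfPlaneSet Q.carrier)
        (y : Fin 4 → ℝ),
        (∃ S : Finset (ℂ × ℂ), (∀ p ∈ S, p.1.re = p.2.re ∨ p.1.im = p.2.im) ∧
          frontier Q.carrier ⊆ ⋃ p ∈ S, segment ℝ p.1 p.2) ∧
        Q.IsUniformizing ψ y ∧ crossRatio y = crossRatio x ∧
        (∀ u : ℝ, dist (Q.boundary u) (R.boundary u) ≤ ε₀) ∧
        (∀ i : Fin 4, |Q.mark i - R.mark i| ≤ ε₀) := by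
  sorry

/-! ### Name-keyed aliases of the three statements

The hypotheses of the composition: the skeleton audit admits a hypothesis only if its head
constant is a registered obligation or is named like a declared stub. -/
namespace Registered

/-- Alias of `MeshLoopContinuity` keyed by the registered stub name. -/
abbrev stub_meshLoopContinuity : Prop := MeshLoopContinuity

/-- Alias of `RectilinearSeqTransport` keyed by the registered stub name. -/
abbrev stub_rectilinearSeqTransport : Prop := RectilinearSeqTransport

/-- Alias of `IsomodularRectilinearApprox` keyed by the registered stub name. -/
abbrev stub_isomodularRectilinearApprox : Prop := IsomodularRectilinearApprox

end Registered

/-! ### The composition: the three stubs imply the crux, by name -/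

/-- **`SeqConfTransport` from the three stubs** (no `sorry`; elementary real analysis).
Given `R, R'` with data of equal cross-ratio, `s → 0⁺`, `P(R, s k) → L`: if `P(R', s k) ↛ L`,
some `ε > 0` and a subsequence `ns` keep `dist (P(R', s (ns n))) L ≥ ε`. S1 gives continuity radii
`ε₀, ε₀'` at `R, R'` for the tolerance `ε/4`; S3 gives rectilinear `Q ≈ R`, `Q' ≈ R'` inside them
with `η(Q) = η(R) = η(R') = η(Q')`; Bolzano–Weierstrass extracts `θ` with
`P(Q, s (ns (θ k))) → L_Q`, whence `|L_Q - L| ≤ ε/4` (S1 at `R` + `le_of_tendsto`); S2 transports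
`L_Q` to `Q'` along `s ∘ ns ∘ θ`; S1 at `R'` then puts `P(R', s (ns (θ k)))` within
`ε/4 + ε/4 + ε/4 < ε` of `L` for some `k` — contradicting the choice of `ns`. -/
theorem SeqConfTransport_of (h₁ : Registered.stub_meshLoopContinuity)
    (h₂ : Registered.stub_rectilinearSeqTransport)
    (h₃ : Registered.stub_isomodularRectilinearApprox) :
    Summit.CriticalPhenomena.CardyFormulaZ2.Theses.CardyCornerFugacity.SeqConfTransport := by
  intro R R' φ x φ' x' hU hU' hη s hs L hL
  rw [Metric.tendsto_nhds]
  intro ε hε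
  by_contra hnot
  obtain ⟨ns, hns, hfar⟩ := Filter.exists_seq_forall_of_frequently (Filter.not_eventually.mp hnot)
  -- continuity radii at `R` and `R'` for the tolerance `ε / 4` (S1)
  obtain ⟨ε₀, hε₀, hcR⟩ := h₁ R (ε / 4) (by positivity)
  obtain ⟨ε₀', hε₀', hcR'⟩ := h₁ R' (ε / 4) (by positivity)
  -- iso-modular rectilinear approximants inside the radii (S3)
  obtain ⟨Q, ψ, y, hQr, hQU, hQη, hQb, hQm⟩ := h₃ R φ x hU ε₀ hε₀
  obtain ⟨Q', ψ', y', hQ'r, hQ'U, hQ'η, hQ'b, hQ'm⟩ := h₃ R' φ' x' hU' ε₀' hε₀'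
  have hcQ : ∀ᶠ δ in 𝓝[>] (0 : ℝ),
      |bondDomainCrossingProb Q δ - bondDomainCrossingProb R δ| ≤ ε / 4 := hcR Q hQb hQm
  have hcQ' : ∀ᶠ δ in 𝓝[>] (0 : ℝ),
      |bondDomainCrossingProb Q' δ - bondDomainCrossingProb R' δ| ≤ ε / 4 := hcR' Q' hQ'b hQ'm
  -- Bolzano–Weierstrass in `[0, 1]` for `P(Q, ·)` along `s ∘ ns`
  obtain ⟨LQ, -, θ, hθ, hLQ⟩ := tendsto_subseq_of_bounded (Metric.isBounded_Icc (0 : ℝ) 1)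
    (x := fun n => bondDomainCrossingProb Q (s (ns n)))
    (fun n => bondDomainCrossingProb_mem_Icc Q (s (ns n)))
  have hs' : Tendsto (fun k => s (ns (θ k))) atTop (𝓝[>] (0 : ℝ)) :=
    hs.comp (hns.comp hθ.tendsto_atTop)
  have hLQ1 : Tendsto (fun k => bondDomainCrossingProb Q (s (ns (θ k)))) atTop (𝓝 LQ) := hLQ
  -- conformal transport `Q → Q'` along the sub-subsequence (S2)
  have hyy' : crossRatio y = crossRatio y' := hQη.trans (hη.trans hQ'η.symm)
  have hLQ' : Tendsto (fun k => bondDomainCrossingProb Q' (s (ns (θ k)))) atTop (𝓝 LQ) :=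
    h₂ Q Q' hQr hQ'r ψ y ψ' y' hQU hQ'U hyy' (fun k => s (ns (θ k))) hs' LQ hLQ1
  -- `|LQ - L| ≤ ε / 4` from S1 at `R`
  have hRL : Tendsto (fun k => bondDomainCrossingProb R (s (ns (θ k)))) atTop (𝓝 L) :=
    hL.comp (hns.comp hθ.tendsto_atTop)
  have hdiff : |LQ - L| ≤ ε / 4 :=
    le_of_tendsto ((hLQ1.sub hRL).abs) (hs'.eventually hcQ)
  -- far out along `ns ∘ θ`, `P(R', ·)` is within `3ε/4` of `L`: contradiction
  have h2 : ∀ᶠ k in atTop, |bondDomainCrossingProb Q' (s (ns (θ k))) -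
      bondDomainCrossingProb R' (s (ns (θ k)))| ≤ ε / 4 := hs'.eventually hcQ'
  have h3 : ∀ᶠ k in atTop, dist (bondDomainCrossingProb Q' (s (ns (θ k)))) LQ < ε / 4 :=
    Metric.tendsto_nhds.1 hLQ' _ (by positivity)
  obtain ⟨k, hk2, hk3⟩ := (h2.and h3).exists
  refine hfar (θ k) ?_
  rw [Real.dist_eq] at hk3 ⊢
  set a := bondDomainCrossingProb R' (s (ns (θ k))) with ha
  set q := bondDomainCrossingProb Q' (s (ns (θ k))) with hq
  have t1 : |a - L| ≤ |a - q| + |q - L| := abs_sub_le a q L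
  have t2 : |q - L| ≤ |q - LQ| + |LQ - L| := abs_sub_le q LQ L
  have t3 : |a - q| = |q - a| := abs_sub_comm a q
  linarith

/-- Wiring check: the registered (sorried) stubs feed `SeqConfTransport_of` as stated (their
spelled-out signatures are definitionally the named statements). An `example`, so that
`SeqConfTransport_of` stays the only named theorem of this file concluding the crux. -/
example : Summit.CriticalPhenomena.CardyFormulaZ2.Theses.CardyCornerFugacity.SeqConfTransport :=
  SeqConfTransport_of stub_meshLoopContinuity stub_rectilinearSeqTransport
    stub_isomodularRectilinearApprox

end Summit.CriticalPhenomena.CardyFormulaZ2.Cruxes.SeqConfTransport.Birth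

end
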